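import Literature.Probability.Percolation.GluingStructure
import Literature.Probability.Percolation.SeededFrontier
import Literature.Probability.Percolation.TileDomain
import HarnessLib

/-!
# The tile data of the gluing zones at terminality

Topic `Probability/Percolation`.  Seventh step of the cell-complex toolkit for the gluing theorem
(Schramm–Smirnov 2011, proof of Thm 1.5, step (C)): the abstract `TileData` of `TileDomain.lean`
is instantiated from the gluing zones `𝒵 : Seeded.Zones` (collar `K`, tube `N`, squares `SQ`,
`GluingStructure.lean`), terminal exploration data `X` (`Seeded.IsTerminal`) and a configuration `ω`:
hub vertices `𝒪 = OReach`, examined open / closed edges, wet faces `𝒟 = DReach`, accessible fresh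
edges `Acc`, window `K ∪ N`.  Under the geometric niceness of the zones (`Zones.Nice`: tube sites
have no far neighbours, the tube is connected, the outside of the window is walkable to infinity)
all axioms hold (`Zones.tileData`); in particular the closure of the accessible fresh region is a
pinch-free, edge-connected, hole-free, lattice-tame cell complex (`TileDomain.lean`), hence a quad
for any four marked traced vertices (`CellQuad.exists_cellQuad`).

* `fresh_endpoints` — fresh edges join window sites (a far endpoint would make the edge eligible);
* `fresh_of_window` — an unexamined lattice edge between window sites is fresh;
* `exists_pocket_escape` — **pockets escape**: a non-accessible fresh window edge is joined through
  such edges to one with a hub endpoint, or meeting an examined closed edge, or next to the outside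
  (otherwise its pocket component would be closed under lattice adjacency, contradicting finiteness);
* `Zones.tileData` and its cell set.

Everything is proved; no named fact is introduced.

## References

* O. Schramm, S. Smirnov, Ann. Probab. 39 (2011), arXiv:1101.5820, proof of Thm 1.5 (C). [SchrammSmirnov2011]
* G. Grimmett, *Percolation* (1999), §11.2. [GrimmettPercolation1999]
-/

noncomputable section

open Set Relation
open Literature.Probability.LatticeModels
open scoped Classical

namespace Literature.Probability.Percolation

namespace Seeded

namespace Zones

variable (𝒵 : Zones) {X : Finset (Sym2 (Site 2))} {ω : BondConfig (Site 2)}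

open CellComplex

/-- **Geometric niceness of the zones**: tube sites have all four neighbours in `K ∪ N ∪ SQ`, the tube
is connected through unit steps, and from every site outside the window `K ∪ N` one can walk off to
infinity outside the window. [cite: SchrammSmirnov2011, §4, proof of Prop. 4.1 (setup)] -/
structure Nice : Prop where
  /-- tube sites have no far neighbours -/
  N_nbr : ∀ v ∈ 𝒵.N, ∀ k : Fin 4, v + cornerUnit k ∈ 𝒵.K ∨ v + cornerUnit k ∈ 𝒵.N ∨ v + cornerUnit k ∈ 𝒵.SQ
  /-- the tube is connected -/
  N_conn : ∀ u ∈ 𝒵.N, ∀ v ∈ 𝒵.N,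
    ReflTransGen (fun a b => a ∈ 𝒵.N ∧ b ∈ 𝒵.N ∧ ∃ k : Fin 4, b = a + cornerUnit k) u v
  /-- the outside of the window is walkable to infinity -/
  W_esc : ∀ u, u ∉ 𝒵.K → u ∉ 𝒵.N → ∀ R : ℝ, ∃ u', R < ‖Site.toComplex u'‖ ∧
    ReflTransGen (fun a b => (a ∉ 𝒵.K ∧ a ∉ 𝒵.N) ∧ (b ∉ 𝒵.K ∧ b ∉ 𝒵.N) ∧ ∃ k : Fin 4, b = a + cornerUnit k) u u'

/-- The window: collar and tube sites. [folklore] -/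
def Wv : Set (Site 2) := {v | v ∈ 𝒵.K ∨ v ∈ 𝒵.N}

/-- Far sites are outside the window. [folklore] -/
theorem not_mem_Wv_of_mem_Far {v : Site 2} (hv : v ∈ 𝒵.Far) : v ∉ 𝒵.Wv := by
  rintro (h | h)
  · exact hv.1 h
  · exact hv.2.1 h

/-! ### Fresh edges and the window -/

/-- **Fresh edges join window sites** (terminality: an examinable edge with a far endpoint is
eligible). [folklore] -/
theorem fresh_endpoints (hT : IsTerminal 𝒵.seeds X ω) (hN : 𝒵.Nice) {e : Sym2 (Site 2)}
    (he : e ∈ 𝒵.fresh X) : ∀ v ∈ e, v ∈ 𝒵.Wv := by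
  intro v hv
  rcases 𝒵.mem_fresh_iff.1 he with ⟨heA, heX⟩ | het
  · obtain ⟨heE, -, hall⟩ := 𝒵.collar.mem_A_iff.1 heA
    rcases hall v hv with hK | hF
    · exact Or.inl hK
    · -- a far endpoint: the edge is eligible
      exfalso
      refine hT.not_eligible e ⟨heA, heX, ⟨v, hv, oReach_of_mem_seeds X ω hF⟩, ?_⟩
      obtain ⟨a, b, -, hab⟩ := exists_dualEdge_eq_mk heE
      refine ⟨a, isFaceOf_left_of_dualEdge_eq hab, dReach_of_mem_seeds X ω ?_⟩
      exact ⟨v, touchesFace_of_isFaceOf heE (isFaceOf_left_of_dualEdge_eq hab) hv, hF⟩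
  · obtain ⟨heE, ⟨u, hue, huN⟩, hSQ⟩ := 𝒵.mem_tubeEdges_iff.1 het
    by_cases huv : v = u
    · exact Or.inr (huv ▸ huN)
    · obtain ⟨k, hk⟩ := exists_eq_dartEdge_of_mem heE hue
      have hvk : v = u + cornerUnit k := by
        have : v ∈ dartEdge u k := hk ▸ hv
        rcases mem_dartEdge_iff.1 this with h | h
        · exact absurd h huv
        · exact h
      rcases hN.N_nbr u huN k with h | h | h
      · exact Or.inl (hvk ▸ h)
      · exact Or.inr (hvk ▸ h)
      · exact absurd (hvk ▸ h) (hSQ v hv)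

/-- **An unexamined lattice edge between window sites is fresh.** [folklore] -/
theorem fresh_of_window {e : Sym2 (Site 2)} (heE : e ∈ (zdGraph 2).edgeSet) (hwin : ∀ v ∈ e, v ∈ 𝒵.Wv)
    (heX : e ∉ X) : e ∈ 𝒵.fresh X := by
  rw [𝒵.mem_fresh_iff]
  have hSQ : ∀ v ∈ e, v ∉ 𝒵.SQ := by
    intro v hv hvS
    rcases hwin v hv with h | h
    · exact Finset.disjoint_left.1 𝒵.disjoint_K_SQ h hvS
    · exact Finset.disjoint_left.1 𝒵.disjoint_N_SQ h hvS
  by_cases hN : ∃ v ∈ e, v ∈ 𝒵.N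
  · exact Or.inr (𝒵.mem_tubeEdges_iff.2 ⟨heE, hN, hSQ⟩)
  · push Not at hN
    have hK : ∀ v ∈ e, v ∈ 𝒵.K := fun v hv => (hwin v hv).resolve_right (hN v hv)
    left
    refine ⟨𝒵.collar.mem_A_iff.2 ⟨heE, ?_, fun v hv => Or.inl (hK v hv)⟩, heX⟩
    induction e using Sym2.ind with
    | h a b => exact ⟨a, Sym2.mem_mk_left a b, hK a (Sym2.mem_mk_left a b)⟩

/-- Hub vertices lie in `K ∪ Far`. [folklore] -/
theorem mem_K_or_Far_of_oReach (hT : IsTerminal 𝒵.seeds X ω) {v : Site 2} (hv : OReach 𝒵.seeds X ω v) :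
    v ∈ 𝒵.K ∨ v ∈ 𝒵.Far := by
  rcases exists_mem_of_oReach hv with h | ⟨e, heX, -, hve⟩
  · exact Or.inr h
  · exact (𝒵.collar.mem_A_iff.1 (hT.subset heX)).2.2 v hve

/-- Tube sites are not hub vertices. [folklore] -/
theorem not_oReach_of_mem_N (hT : IsTerminal 𝒵.seeds X ω) {v : Site 2} (hv : v ∈ 𝒵.N) :
    ¬ OReach 𝒵.seeds X ω v := fun h => by
  rcases 𝒵.mem_K_or_Far_of_oReach hT h with hK | hF
  · exact Finset.disjoint_left.1 𝒵.disjoint_K_N hK hv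
  · exact hF.2.1 hv

/-! ### Pockets escape -/

/-- **Pockets escape.**  A fresh non-accessible window edge is joined, through fresh non-accessible
window edges sharing sites, to one with an endpoint in `𝒪`, or meeting an examined closed edge, or
with an endpoint next to a site outside the window. [folklore] -/
theorem exists_pocket_escape (hT : IsTerminal 𝒵.seeds X ω) {e : Sym2 (Site 2)}
    (heE : e ∈ (zdGraph 2).edgeSet) (hwin : ∀ v ∈ e, v ∈ 𝒵.Wv) (heX : e ∉ X) (hacc : ¬ 𝒵.Acc X ω e) :
    ∃ e' u, u ∈ e' ∧
      (OReach 𝒵.seeds X ω u ∨ (∃ c, (c ∈ X ∧ c ∉ ω) ∧ c ∈ (zdGraph 2).edgeSet ∧ u ∈ c) ∨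
        (∃ k : Fin 4, u + cornerUnit k ∉ 𝒵.Wv)) ∧
      ReflTransGen (fun a b => b ∈ (zdGraph 2).edgeSet ∧ (∀ v ∈ b, v ∈ 𝒵.Wv) ∧ ¬ (b ∈ X ∧ b ∈ ω) ∧
        ¬ (b ∈ X ∧ b ∉ ω) ∧ b ∉ (𝒵.fresh X).filter (fun e => 𝒵.Acc X ω e) ∧ ∃ u, u ∈ a ∧ u ∈ b) e e' := by
  -- the pocket component of `e`
  set R : Sym2 (Site 2) → Sym2 (Site 2) → Prop := fun a b => b ∈ (zdGraph 2).edgeSet ∧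
    (∀ v ∈ b, v ∈ 𝒵.Wv) ∧ ¬ (b ∈ X ∧ b ∈ ω) ∧ ¬ (b ∈ X ∧ b ∉ ω) ∧
    b ∉ (𝒵.fresh X).filter (fun e => 𝒵.Acc X ω e) ∧ ∃ u, u ∈ a ∧ u ∈ b with hR
  by_contra hno
  push Not at hno
  -- `hno : ∀ e' u, u ∈ e' → (escape at u) → ¬ R* e e'`, reorganised
  have hclosed : ∀ e', ReflTransGen R e e' → ∀ u ∈ e', ¬ OReach 𝒵.seeds X ω u ∧
      (∀ c, c ∈ X → c ∉ ω → c ∈ (zdGraph 2).edgeSet → u ∉ c) ∧ ∀ k : Fin 4, u + cornerUnit k ∈ 𝒵.Wv := by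
    intro e' he' u hu
    have h := hno e' u hu
    refine ⟨fun hO => h (Or.inl hO) he', fun c hcX hcω hcE huc => h (Or.inr (Or.inl ⟨c, ⟨hcX, hcω⟩, hcE, huc⟩)) he',
      fun k => ?_⟩
    by_contra hk
    exact h (Or.inr (Or.inr ⟨k, hk⟩)) he'
  -- invariants along the component: lattice edge, window, unexamined, not accessible
  have hinv : ∀ e', ReflTransGen R e e' → e' ∈ (zdGraph 2).edgeSet ∧ (∀ v ∈ e', v ∈ 𝒵.Wv) ∧ e' ∉ X ∧
      ¬ 𝒵.Acc X ω e' := by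
    intro e' he'
    induction he' with
    | refl =>
      exact ⟨heE, hwin, heX, hacc⟩
    | tail _ hst _ =>
      rename_i b c hab ih
      obtain ⟨hbE, hbwin, hbo, hbc, hbacc, -⟩ := hst
      refine ⟨hbE, hbwin, fun hbX => ?_, fun hA => hbacc ?_⟩
      · by_cases hbω : c ∈ ω
        · exact hbo ⟨hbX, hbω⟩
        · exact hbc ⟨hbX, hbω⟩
      · exact Finset.mem_filter.2 ⟨hA.mem_fresh, hA⟩
  -- closure under lattice adjacency: every edge at a vertex of the component is in the component
  have hstep : ∀ e', ReflTransGen R e e' → ∀ u ∈ e', ∀ k : Fin 4, ReflTransGen R e (dartEdge u k) := by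
    intro e' he' u hu k
    obtain ⟨he'E, he'win, he'X, he'acc⟩ := hinv e' he'
    obtain ⟨huO, hucl, hunbr⟩ := hclosed e' he' u hu
    have hdE := dartEdge_mem_edgeSet u k
    have hdwin : ∀ v ∈ dartEdge u k, v ∈ 𝒵.Wv := by
      intro v hv
      rcases mem_dartEdge_iff.1 hv with rfl | rfl
      · exact he'win _ hu
      · exact hunbr k
    have hdu : u ∈ dartEdge u k := mem_dartEdge_iff.2 (Or.inl rfl)
    -- the dart edge is unexamined: open examined would put `u` in `𝒪`, closed examined is excluded
    have hdX : dartEdge u k ∉ X := by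
      intro hdX
      by_cases hdω : dartEdge u k ∈ ω
      · exact huO (hT.oReach_of_mem hdX hdω hdu)
      · exact hucl _ hdX hdω hdE hdu
    -- hence fresh, and not accessible (else `e'` would be accessible through `u ∉ 𝒪`)
    have hdfresh : dartEdge u k ∈ 𝒵.fresh X := 𝒵.fresh_of_window hdE hdwin hdX
    have hdacc : ¬ 𝒵.Acc X ω (dartEdge u k) := fun hA =>
      he'acc (hA.step (𝒵.fresh_of_window he'E he'win he'X) hdu hu huO)
    refine he'.tail ⟨hdE, hdwin, fun h => hdX h.1, fun h => hdX h.1, ?_, u, hu, hdu⟩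
    exact fun h => hdacc (Finset.mem_filter.1 h).2
  -- hence all translates of a vertex of `e` in direction `0` carry component edges: unbounded
  obtain ⟨u₀, hu₀⟩ : ∃ u, u ∈ e := by
    induction e using Sym2.ind with
    | h a b => exact ⟨a, Sym2.mem_mk_left a b⟩
  have hall : ∀ n : ℕ, ReflTransGen R e (dartEdge (u₀ + (n : ℤ) • cornerUnit 0) 0) := by
    intro n
    induction n with
    | zero => simpa using hstep e ReflTransGen.refl u₀ hu₀ 0
    | succ n ih =>
      have hmem : u₀ + ((n : ℤ) + 1) • cornerUnit 0 ∈ dartEdge (u₀ + (n : ℤ) • cornerUnit 0) 0 := by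
        rw [mem_dartEdge_iff]; right; rw [add_smul, one_smul, add_assoc]
      have := hstep _ ih _ hmem 0
      push_cast at this ⊢
      exact this
  -- all these edges are fresh, a finite set; but they are pairwise distinct
  have hfresh : ∀ n : ℕ, dartEdge (u₀ + (n : ℤ) • cornerUnit 0) 0 ∈ 𝒵.fresh X := fun n => by
    obtain ⟨hE, hw, hX, -⟩ := hinv _ (hall n)
    exact 𝒵.fresh_of_window hE hw hX
  have hinj : Function.Injective fun n : ℕ => dartEdge (u₀ + (n : ℤ) • cornerUnit 0) 0 := by
    intro m n h
    have := congrArg bcell h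
    simp only [bcell_dartEdge] at this
    have h0 := congr_fun this 0
    rw [βc_apply, βc_apply] at h0
    simp [cornerUnit] at h0
    exact_mod_cast h0
  have hfin : (Set.range fun n : ℕ => dartEdge (u₀ + (n : ℤ) • cornerUnit 0) 0).Finite :=
    (𝒵.fresh X).finite_toSet.subset (by rintro _ ⟨n, rfl⟩; exact hfresh n)
  exact Set.infinite_range_of_injective hinj hfin

/-! ### Corners and sides of a face -/

/-- The corners of the face `F` are the sites `F + cornerOff m`. [folklore] -/
theorem touchesFace_iff_exists_cornerOff {s F : Site 2} : TouchesFace s F ↔ ∃ m : Fin 4, s = F + cornerOff m := by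
  rw [touchesFace_iff]
  constructor
  · rintro (h | h | h | h)
    · exact ⟨0, by rw [h]; simp [cornerOff]⟩
    · exact ⟨1, by rw [h]; simp [cornerOff]⟩
    · exact ⟨3, by rw [h]; simp [cornerOff]⟩
    · exact ⟨2, by rw [h]; simp only [cornerOff]; abel⟩
  · rintro ⟨m, rfl⟩
    fin_cases m
    · left; simp [cornerOff]
    · right; left; simp [cornerOff]
    · right; right; right; simp only [cornerOff]; abel
    · right; right; left; simp [cornerOff]

/-- The endpoints of the `m`-th side of `F`. [folklore] -/
theorem mem_faceSide_iff {F v : Site 2} {m : Fin 4} :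
    v ∈ faceSide F m ↔ v = F + cornerOff m ∨ v = F + cornerOff (m + 1) := by
  rw [faceSide, mem_dartEdge_iff, cornerUnit_eq_off_sub]
  constructor <;> rintro (h | h)
  · exact Or.inl h
  · right; rw [h]; abel
  · exact Or.inl h
  · right; rw [h]; abel

/-- Distinct corner indices give distinct corners. [folklore] -/
theorem cornerOff_add_inj (F : Site 2) {m m' : Fin 4} (h : F + cornerOff m = F + cornerOff m') : m = m' :=
  cornerOff_injective (add_left_cancel h)

/-- **The sides of `F` through its corner `F + cornerOff j`** are the sides `j` and `j + 3`. [folklore] -/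
theorem faceSide_of_mem_corner {F : Site 2} {j : Fin 4} {e : Sym2 (Site 2)} (he : e ∈ (zdGraph 2).edgeSet)
    (hF : IsFaceOf F e) (hw : F + cornerOff j ∈ e) : e = faceSide F j ∨ e = faceSide F (j + 3) := by
  obtain ⟨m, rfl⟩ := (isFaceOf_iff_exists_faceSide he).1 hF
  rcases mem_faceSide_iff.1 hw with h | h
  · left; rw [cornerOff_add_inj F h]
  · right
    have : j = m + 1 := cornerOff_add_inj F h
    rw [this, fin4_add_one_add_three]

/-! ### The tile data of the zones -/

/-- **The tile data of the gluing zones at terminality.** [cite: SchrammSmirnov2011, proof of Thm 1.5 (C)] -/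
def tileData (hT : IsTerminal 𝒵.seeds X ω) (hN : 𝒵.Nice) : TileData where
  O := {v | OReach 𝒵.seeds X ω v}
  hubE := {e | e ∈ X ∧ e ∈ ω}
  clE := {e | e ∈ X ∧ e ∉ ω}
  Dset := {f | DReach 𝒵.seeds X ω f}
  acc := (𝒵.fresh X).filter fun e => 𝒵.Acc X ω e
  Wv := 𝒵.Wv
  acc_edge e he := 𝒵.mem_edgeSet_of_mem_fresh (Finset.mem_filter.1 he).1
  acc_window e he := 𝒵.fresh_endpoints hT hN (Finset.mem_filter.1 he).1
  acc_not_hub e he h := 𝒵.not_mem_of_mem_fresh hT.subset (Finset.mem_filter.1 he).1 h.1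
  acc_not_cl e he h := 𝒵.not_mem_of_mem_fresh hT.subset (Finset.mem_filter.1 he).1 h.1
  hub_edge e he := 𝒵.seeds.A_subset e (hT.subset he.1)
  hub_O e he v hv := hT.oReach_of_mem he.1 he.2 hv
  cl_O e he := (hT.two_arms e he.1).1
  cl_D e he f hf := hT.dReach_of_mem he.1 he.2 hf
  closure e he w hwe hwO e' he'E hwe' hwin := by
    by_cases he'X : e' ∈ X
    · by_cases he'ω : e' ∈ ω
      · exact Or.inl ⟨he'X, he'ω⟩
      · exact Or.inr (Or.inl ⟨he'X, he'ω⟩)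
    · right; right
      have hfr : e' ∈ 𝒵.fresh X := 𝒵.fresh_of_window he'E hwin he'X
      exact Finset.mem_filter.2 ⟨hfr, (Finset.mem_filter.1 he).2.step hfr hwe hwe' hwO⟩
  T3 f hf w hwO e₁ he₁ e₂ he₂ hne hw₁ hw₂ hf₁ hf₂ := by
    have hne1 : ∀ j : Fin 4, j + 1 ≠ j := by decide
    have hne3 : ∀ j : Fin 4, j + 3 ≠ j := by decide
    obtain ⟨he₁f, he₁acc⟩ := Finset.mem_filter.1 he₁
    obtain ⟨he₂f, he₂acc⟩ := Finset.mem_filter.1 he₂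
    -- an examinable accessible edge at a hub vertex has no wet face; so both are tube edges
    have key : ∀ e, e ∈ 𝒵.fresh X → w ∈ e → IsFaceOf f e → e ∈ 𝒵.tubeEdges := by
      intro e hef hwe hfe
      rcases 𝒵.mem_fresh_iff.1 hef with ⟨heA, heX⟩ | het
      · exact absurd hf (hT.not_dReach_of_not_mem heA heX hwe hwO hfe)
      · exact het
    have ht₁ := key e₁ he₁f hw₁ hf₁
    have ht₂ := key e₂ he₂f hw₂ hf₂
    -- `w ∈ 𝒪 ⊆ K ∪ Far`, an endpoint of a tube edge: so `w ∈ K` and the other endpoints are in `N`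
    have hwK : w ∈ 𝒵.K := by
      rcases 𝒵.mem_K_or_Far_of_oReach hT hwO with h | h
      · exact h
      · exact absurd (𝒵.fresh_endpoints hT hN he₁f w hw₁) (𝒵.not_mem_Wv_of_mem_Far h)
    -- `w` is a corner of `f`: `w = f + cornerOff j`
    have hwf : TouchesFace w f := touchesFace_of_isFaceOf (𝒵.mem_edgeSet_of_mem_fresh he₁f) hf₁ hw₁
    obtain ⟨j, hj⟩ := touchesFace_iff_exists_cornerOff.1 hwf
    have he₁E := 𝒵.mem_edgeSet_of_mem_fresh he₁f
    have he₂E := 𝒵.mem_edgeSet_of_mem_fresh he₂f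
    have hs₁ := faceSide_of_mem_corner he₁E hf₁ (hj ▸ hw₁)
    have hs₂ := faceSide_of_mem_corner he₂E hf₂ (hj ▸ hw₂)
    -- the two sides at `w` are `{e₁, e₂} = {side j, side (j+3)}`, both tube edges
    have hsides : ∀ e, (e = faceSide f j ∨ e = faceSide f (j + 3)) → e ∈ 𝒵.tubeEdges := by
      rintro e (rfl | rfl)
      · rcases hs₁ with h | h
        · exact h ▸ ht₁
        · rcases hs₂ with h' | h'
          · exact h' ▸ ht₂
          · exact absurd (h.trans h'.symm) hne
      · rcases hs₁ with h | h
        · rcases hs₂ with h' | h'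
          · exact absurd (h.trans h'.symm) hne
          · exact h' ▸ ht₂
        · exact h ▸ ht₁
    -- the other endpoints of the two sides at `w` are in `N`
    have hwN : w ∉ 𝒵.N := fun h => Finset.disjoint_left.1 𝒵.disjoint_K_N hwK h
    have hN_of_side : ∀ e ∈ 𝒵.tubeEdges, w ∈ e → ∀ v ∈ e, v ≠ w → v ∈ 𝒵.N := by
      intro e het hwe v hve hvw
      obtain ⟨-, ⟨u, hue, huN⟩, -⟩ := 𝒵.mem_tubeEdges_iff.1 het
      by_cases huw : u = w
      · exact absurd (huw ▸ huN) hwN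
      · -- `e = s(u, w)` and `v ∈ e`, `v ≠ w` ⇒ `v = u`
        have he : e = s(u, w) := (Sym2.mem_and_mem_iff huw).1 ⟨hue, hwe⟩
        rw [he, Sym2.mem_iff] at hve
        rcases hve with rfl | rfl
        · exact huN
        · exact absurd rfl hvw
    have hc1 : f + cornerOff (j + 1) ∈ 𝒵.N := by
      refine hN_of_side _ (hsides _ (Or.inl rfl)) (mem_faceSide_iff.2 (Or.inl hj)) _
        (mem_faceSide_iff.2 (Or.inr rfl)) fun h => ?_
      exact hne1 j (cornerOff_add_inj f (h.trans hj))
    have hc3 : f + cornerOff (j + 3) ∈ 𝒵.N := by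
      refine hN_of_side _ (hsides _ (Or.inr rfl)) (mem_faceSide_iff.2 (Or.inr (by rw [fin4_add_three_add_one]; exact hj))) _
        (mem_faceSide_iff.2 (Or.inl rfl)) fun h => ?_
      exact hne3 j (cornerOff_add_inj f (h.trans hj))
    -- the fourth corner is a lattice neighbour of the corner `j + 1`, hence not far
    have hc2 : f + cornerOff (j + 2) ∈ 𝒵.K ∨ f + cornerOff (j + 2) ∈ 𝒵.N ∨ f + cornerOff (j + 2) ∈ 𝒵.SQ := by
      have : f + cornerOff (j + 2) = f + cornerOff (j + 1) + cornerUnit (j + 1) := by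
        rw [cornerUnit_eq_off_sub, fin4_add_one_add_one]; abel
      rw [this]
      exact hN.N_nbr _ hc1 (j + 1)
    -- the wet face `f` is a seed face or has an examined closed side
    rcases exists_mem_of_dReach hf with hD₀ | ⟨c, hcX, hcω, hfc⟩
    · obtain ⟨s, hsf, hsFar⟩ := hD₀
      obtain ⟨m, rfl⟩ := touchesFace_iff_exists_cornerOff.1 hsf
      obtain ⟨i, rfl⟩ := fin4_exists_add j m
      fin_cases i
      · simp only [Fin.zero_eta, add_zero] at hsFar
        exact hsFar.1 (hj ▸ hwK)
      · simp only [Fin.mk_one] at hsFar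
        exact hsFar.2.1 hc1
      · simp only [Fin.reduceFinMk] at hsFar
        rcases hc2 with h | h | h
        · exact hsFar.1 h
        · exact hsFar.2.1 h
        · exact hsFar.2.2 h
      · simp only [Fin.reduceFinMk] at hsFar
        exact hsFar.2.1 hc3
    · -- an examined closed side `c` of `f`: not one of the two fresh sides at `w`; the other two
      -- sides have an endpoint in `N`, impossible for an examinable edge
      have hcA := hT.subset hcX
      have hcE := 𝒵.seeds.A_subset c hcA
      obtain ⟨m, rfl⟩ := (isFaceOf_iff_exists_faceSide hcE).1 hfc
      obtain ⟨i, rfl⟩ := fin4_exists_add j m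
      have hKF : ∀ v ∈ faceSide f (j + i), v ∈ 𝒵.K ∨ v ∈ 𝒵.Far := (𝒵.collar.mem_A_iff.1 hcA).2.2
      have hnotN : ∀ v ∈ faceSide f (j + i), v ∉ 𝒵.N := fun v hv hvN => by
        rcases hKF v hv with h | h
        · exact Finset.disjoint_left.1 𝒵.disjoint_K_N h hvN
        · exact h.2.1 hvN
      have hfreshX : ∀ e ∈ 𝒵.tubeEdges, e ∉ X := fun e het heX =>
        𝒵.not_mem_A_of_mem_tubeEdges het (hT.subset heX)
      fin_cases i
      · exact hfreshX _ (hsides _ (Or.inl (by simp))) hcX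
      · exact hnotN _ (mem_faceSide_iff.2 (Or.inl rfl)) (by simpa using hc1)
      · refine hnotN _ (mem_faceSide_iff.2 (Or.inr ?_)) hc3
        simp only [Fin.reduceFinMk]; rw [LatticeModels.fin4_add_two_add_one]
      · exact hfreshX _ (hsides _ (Or.inr (by simp))) hcX
  acc_nonO e he := by
    obtain ⟨-, e₀, he₀, h⟩ := Finset.mem_filter.1 he
    -- a tube edge has a tube endpoint; an `AccStep` target shares a non-hub site
    cases h with
    | refl =>
      obtain ⟨-, ⟨n, hn, hnN⟩, -⟩ := 𝒵.mem_tubeEdges_iff.1 he₀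
      exact ⟨n, hn, 𝒵.not_oReach_of_mem_N hT hnN⟩
    | tail _ hst =>
      obtain ⟨-, v, -, hv, hvO⟩ := hst
      exact ⟨v, hv, hvO⟩
  acc_conn e he e' he' := by
    -- chains in the target relation
    set S : Sym2 (Site 2) → Sym2 (Site 2) → Prop := fun a b =>
      a ∈ (𝒵.fresh X).filter (fun e => 𝒵.Acc X ω e) ∧ b ∈ (𝒵.fresh X).filter (fun e => 𝒵.Acc X ω e) ∧
        ∃ w, w ∈ a ∧ w ∈ b ∧ w ∉ {v | OReach 𝒵.seeds X ω v} with hS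
    have memacc : ∀ {a}, 𝒵.Acc X ω a → a ∈ (𝒵.fresh X).filter (fun e => 𝒵.Acc X ω e) := fun ha =>
      Finset.mem_filter.2 ⟨ha.mem_fresh, ha⟩
    have Ssymm : ∀ {a b}, S a b → S b a := fun ⟨ha, hb, w, hwa, hwb, hwO⟩ => ⟨hb, ha, w, hwb, hwa, hwO⟩
    have RTsymm : ∀ {a b}, ReflTransGen S a b → ReflTransGen S b a := by
      intro a b h
      induction h with
      | refl => exact ReflTransGen.refl
      | tail _ hst ih => exact ReflTransGen.head (Ssymm hst) ih
    -- from a tube edge to an accessible edge along `AccStep`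
    have fromTube : ∀ {e₀ a}, e₀ ∈ 𝒵.tubeEdges → ReflTransGen (𝒵.AccStep X ω) e₀ a → ReflTransGen S e₀ a := by
      intro e₀ a he₀ h
      induction h with
      | refl => exact ReflTransGen.refl
      | tail hab hst ih =>
        obtain ⟨hbf, v, hva, hvb, hvO⟩ := hst
        exact ih.tail ⟨memacc ⟨e₀, he₀, hab⟩, memacc ⟨e₀, he₀, hab.tail ⟨hbf, v, hva, hvb, hvO⟩⟩, v, hva, hvb, hvO⟩
    -- tube edges are chained through tube sites
    have tubeAcc : ∀ n ∈ 𝒵.N, ∀ k : Fin 4, n + cornerUnit k ∈ 𝒵.N → 𝒵.Acc X ω (dartEdge n k) := by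
      intro n hn k hnk
      refine acc_of_mem_tubeEdges (𝒵.mem_tubeEdges_iff.2 ⟨dartEdge_mem_edgeSet n k,
        ⟨n, mem_dartEdge_iff.2 (Or.inl rfl), hn⟩, fun v hv => ?_⟩)
      rcases mem_dartEdge_iff.1 hv with rfl | rfl
      · exact fun h => Finset.disjoint_left.1 𝒵.disjoint_N_SQ hn h
      · exact fun h => Finset.disjoint_left.1 𝒵.disjoint_N_SQ hnk h
    have tubeChain : ∀ {e₀ : Sym2 (Site 2)} {n₀ n : Site 2}, 𝒵.Acc X ω e₀ → n₀ ∈ e₀ → n₀ ∈ 𝒵.N →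
        ReflTransGen (fun a b => a ∈ 𝒵.N ∧ b ∈ 𝒵.N ∧ ∃ k : Fin 4, b = a + cornerUnit k) n₀ n →
        ∃ a, 𝒵.Acc X ω a ∧ n ∈ a ∧ ReflTransGen S e₀ a := by
      intro e₀ n₀ n he₀ hn₀ hn₀N h
      induction h with
      | refl => exact ⟨e₀, he₀, hn₀, ReflTransGen.refl⟩
      | tail _ hst ih =>
        obtain ⟨haN, hbN, k, rfl⟩ := hst
        obtain ⟨a, ha, hna, hchain⟩ := ih
        have hd := tubeAcc _ haN k hbN
        refine ⟨dartEdge _ k, hd, mem_dartEdge_iff.2 (Or.inr rfl), hchain.tail ⟨memacc ha, memacc hd, _, hna,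
          mem_dartEdge_iff.2 (Or.inl rfl), 𝒵.not_oReach_of_mem_N hT haN⟩⟩
    -- assemble
    obtain ⟨-, hacc⟩ := Finset.mem_filter.1 he
    obtain ⟨-, hacc'⟩ := Finset.mem_filter.1 he'
    obtain ⟨e₀, he₀, h₀⟩ := hacc
    obtain ⟨e₀', he₀', h₀'⟩ := hacc'
    obtain ⟨-, ⟨n₀, hn₀, hn₀N⟩, -⟩ := 𝒵.mem_tubeEdges_iff.1 he₀
    obtain ⟨-, ⟨n₀', hn₀', hn₀'N⟩, -⟩ := 𝒵.mem_tubeEdges_iff.1 he₀'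
    obtain ⟨a, ha, hna, hchain⟩ := tubeChain (acc_of_mem_tubeEdges he₀) hn₀ hn₀N (hN.N_conn _ hn₀N _ hn₀'N)
    have hlast : S a e₀' := ⟨memacc ha, memacc (acc_of_mem_tubeEdges he₀'), n₀', hna, hn₀',
      𝒵.not_oReach_of_mem_N hT hn₀'N⟩
    exact (RTsymm (fromTube he₀ h₀)).trans ((hchain.tail hlast).trans (fromTube he₀' h₀'))
  esc_W u hu R := by
    have hu' : u ∉ 𝒵.K ∧ u ∉ 𝒵.N := ⟨fun h => hu (Or.inl h), fun h => hu (Or.inr h)⟩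
    obtain ⟨u', hfar, hwalk⟩ := hN.W_esc u hu'.1 hu'.2 R
    refine ⟨u', hfar, ?_⟩
    clear hfar
    induction hwalk with
    | refl => exact ReflTransGen.refl
    | tail _ hst ih =>
      obtain ⟨ha, hb, hk⟩ := hst
      exact ih.tail ⟨fun h => h.elim ha.1 ha.2, fun h => h.elim hb.1 hb.2, hk⟩
  esc_O v hv := by
    obtain ⟨s, hs, hchain⟩ := hv
    refine ⟨s, 𝒵.not_mem_Wv_of_mem_Far hs, ?_⟩
    -- reverse the `OReach` chain
    clear hs
    induction hchain with
    | refl => exact ReflTransGen.refl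
    | tail _ hst ih => exact ReflTransGen.head (by rw [Sym2.eq_swap]; exact ⟨hst.1, hst.2⟩) ih
  esc_D f hf := by
    obtain ⟨g, hg, hchain⟩ := hf
    refine ⟨g, ?_, ?_⟩
    · obtain ⟨u, hug, huF⟩ := hg
      exact ⟨u, 𝒵.not_mem_Wv_of_mem_Far huF, hug⟩
    · -- reverse the `DReach` chain, recording wetness of the earlier face
      have key : ∀ b, ReflTransGen (fun a b => ∃ e ∈ X, e ∉ ω ∧ e ∈ (zdGraph 2).edgeSet ∧ dualEdge e = s(a, b)) g b →
          ReflTransGen (fun a b => b ∈ {f | DReach 𝒵.seeds X ω f} ∧ ∃ c ∈ {e : Sym2 (Site 2) | e ∈ X ∧ e ∉ ω},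
            c ∈ (zdGraph 2).edgeSet ∧ IsFaceOf a c ∧ IsFaceOf b c) b g := by
        intro b hb
        induction hb with
        | refl => exact ReflTransGen.refl
        | tail hab hst ih =>
          rename_i a' b'
          obtain ⟨e, heX, heω, heE, hd⟩ := hst
          have ha'D : DReach 𝒵.seeds X ω a' := ⟨g, hg, hab⟩
          exact ReflTransGen.head ⟨ha'D, e, ⟨heX, heω⟩, heE, isFaceOf_right_of_dualEdge_eq hd,
            isFaceOf_left_of_dualEdge_eq hd⟩ ih
      exact key f hchain
  esc_P e heE hwin hh hcl hacc := by
    have heX : e ∉ X := fun h => by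
      by_cases hω : e ∈ ω
      · exact hh ⟨h, hω⟩
      · exact hcl ⟨h, hω⟩
    have hacc' : ¬ 𝒵.Acc X ω e := fun h => hacc (Finset.mem_filter.2 ⟨h.mem_fresh, h⟩)
    obtain ⟨e', u, hue', hend, hchain⟩ := 𝒵.exists_pocket_escape hT heE hwin heX hacc'
    exact ⟨e', u, hue', hend, hchain⟩

end Zones

end Seeded

end Literature.Probability.Percolation

end
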